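import Literature.NumberTheory.Automorphic.KirillovShapeMellinGL2
import Literature.Analysis.FunctionSpaces.BesselKProductMellin
import HarnessLib

/-!
# Mellin transforms of PRODUCTS of two Kirillov shape functions of `GL₂` (the local integrals of the
# archimedean `GL₂ × GL₂` Rankin–Selberg computation; Jacquet (1972), §17–§19)

Topic `NumberTheory/Automorphic`; namespace `Literature.NumberTheory.Automorphic`. Theorems only (no
definition, no named fact, no instance). Companion of `KirillovShapeMellinGL2` (Mellin transforms of ONE
shape function, the local integrals of the Hecke theory of `GL₂`): the torus reduction of the archimedean
Rankin–Selberg integral (`ArchRankinSelbergTorusReductionGL2`) leaves the Mellin transform over `K_∞ˣ` of a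
PRODUCT `W_e(a(t)) conj W'_{e'}(a(t))` of two Kirillov functions, which for the tree's test vectors are
products over the places of the shape functions `realShapeFn c₊ c₋ Φ` (`Φ = expShape β a = u^β e^{-au}` or
`besselShape β a ν = u^β k_ν(u)`, `k_ν(u) = besselMode a ν u = 2√u K_{iν}(au)`) and of radial Bessel shapes
on `ℂ` (`ArchKirillovFactorisationGL2`, `ArchHeckeTestVectorGammaGL2`). This file computes the local
integrals of such products:

* §1 algebra: products and complex conjugates of shape functions are shape functions
  (`realShapeFn_mul_realShapeFn`, `conj_realShapeFn`, `conj_expShape`, `conj_besselShape`,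
  `expShape_mul_expShape` — so `exp × exp` is again `integral_expShape_mul`);
* §2 on `(0, ∞)`: `∫₀^∞ u^β e^{-au} · u^{β'} k_ν(u) · u^w du = 2 a^{-z} √π Γ(z+iν) Γ(z-iν) / (2^z Γ(z+½))`,
  `z = β + β' + w + 3/2` (`integral_expShape_mul_besselShape_mul_cpow`, from the tree's
  `∫₀^∞ y^{μ-1} e^{-y} K_ν(y) dy`, `BesselKExpMellin`), and
  `∫₀^∞ u^β k_ν(u) · u^{β'} k_{ν'}(u) · u^w du = 4 a^{-z} 2^{z-3} ∏_{±,±} Γ((z ± iν ± iν')/2) / Γ(z)`,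
  `z = β + β' + w + 2` (`integral_besselShape_mul_besselShape_mul_cpow`, from the tree's Mellin transform
  of `K_μ K_ν`, `BesselKProductMellin`), each with integrability;
* §3 on `ℂ` (polar coordinates): `∫_ℂ |z|^β k_ν(|z|) |z|^{β'} k_{ν'}(|z|) (|z|²)^w dz = 2π · 4 a^{-z'} 2^{z'-3}
  ∏ Γ((z' ± iν ± iν')/2) / Γ(z')`, `z' = β + β' + 2w + 3` (`integral_complex_besselShape_mul_besselShape`).

These are exactly the `exp × K`, `K × K` and radial `K × K` integrals of Jacquet's computation of
`Ψ(s, W, W', Φ)` for `GL₂(ℝ)` (discrete series × principal series, principal × principal) and `GL₂(ℂ)`;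
the Gamma-factor bookkeeping (Legendre duplication, cancellation against Tate's factor) is NOT done here.

## References

* H. Jacquet, *Automorphic Forms on GL(2), Part II*, LNM 278 (1972), §17–§19 [Jacquet1972GL2II].
* G. N. Watson, *A Treatise on the Theory of Bessel Functions*, §13.21 (8), §13.72 [Watson1944].
* H. Jacquet, R. P. Langlands, *Automorphic Forms on GL(2)*, LNM 114 (1970), §5 Thm. 5.15, §6 Thm. 6.4
  [JacquetLanglands1970].
-/

noncomputable section

open MeasureTheory Measure Set Filter
open scoped Topology ComplexConjugate

namespace Literature.NumberTheory.Automorphic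

open Literature.Analysis.FunctionSpaces

/-! ### 1. Algebra of shape functions -/

section Algebra

/-- The product of two real shape functions with profiles `Φ, Φ'` is the real shape function with profile
`Φ Φ'` and constants `c₊ c'₊`, `c₋ c'₋`. [folklore] -/
theorem realShapeFn_mul_realShapeFn (cp cm cp' cm' : ℂ) (Φ Φ' : ℝ → ℂ) (t : ℝ) :
    realShapeFn cp cm Φ t * realShapeFn cp' cm' Φ' t = realShapeFn (cp * cp') (cm * cm') (fun u => Φ u * Φ' u) t := by
  rcases lt_trichotomy t 0 with h | rfl | h
  · rw [realShapeFn_of_neg cp cm Φ h, realShapeFn_of_neg cp' cm' Φ' h, realShapeFn_of_neg _ _ _ h]; ring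
  · rw [realShapeFn_zero, realShapeFn_zero, realShapeFn_zero, zero_mul]
  · rw [realShapeFn_of_pos cp cm Φ h, realShapeFn_of_pos cp' cm' Φ' h, realShapeFn_of_pos _ _ _ h]; ring

/-- The complex conjugate of a real shape function. [folklore] -/
theorem conj_realShapeFn (cp cm : ℂ) (Φ : ℝ → ℂ) (t : ℝ) :
    conj (realShapeFn cp cm Φ t) = realShapeFn (conj cp) (conj cm) (fun u => conj (Φ u)) t := by
  rcases lt_trichotomy t 0 with h | rfl | h
  · rw [realShapeFn_of_neg cp cm Φ h, realShapeFn_of_neg _ _ _ h, map_mul]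
  · rw [realShapeFn_zero, realShapeFn_zero, map_zero]
  · rw [realShapeFn_of_pos cp cm Φ h, realShapeFn_of_pos _ _ _ h, map_mul]

/-- `conj (u^β e^{-au}) = u^{β̄} e^{-au}` for `u ≥ 0`. [folklore] -/
theorem conj_expShape {u : ℝ} (hu : 0 ≤ u) (β : ℂ) (a : ℝ) : conj (expShape β a u) = expShape (conj β) a u := by
  have h : (u : ℂ).arg ≠ Real.pi := by
    rw [Complex.arg_ofReal_of_nonneg hu]; exact Real.pi_ne_zero.symm
  rw [expShape, expShape, map_mul, ← Complex.exp_conj, map_mul, map_neg, Complex.conj_ofReal, Complex.conj_ofReal,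
    Complex.cpow_conj _ _ h, Complex.conj_ofReal]

/-- `conj k_ν(u) = k_{ν̄}(u)` for `u > 0` (`k_ν = besselMode a ν = 2√u K_{iν}(au)`, `conj K_μ(x) = K_{μ̄}(x)` and
`conj(iν) = -iν̄`, `K_{-μ} = K_μ`). [folklore] -/
theorem conj_besselMode {a u : ℝ} (ha : 0 < a) (hu : 0 < u) (ν : ℂ) :
    conj (besselMode a ν u) = besselMode a (conj ν) u := by
  rw [besselMode_eq_two_mul_sqrt_mul_besselK ha hu, besselMode_eq_two_mul_sqrt_mul_besselK ha hu, map_mul, map_mul,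
    map_ofNat, Complex.conj_ofReal]
  congr 1
  rw [besselK_def, besselK_def, ← integral_conj]
  refine setIntegral_congr_fun measurableSet_Ioi fun t _ => ?_
  rw [map_mul, ← Complex.exp_conj, ← Complex.cosh_conj, map_mul, map_mul, map_neg, map_mul, Complex.conj_ofReal,
    Complex.conj_ofReal, Complex.conj_ofReal, Complex.conj_I]
  congr 1
  rw [← Complex.cosh_neg]
  congr 1
  ring

/-- `conj (u^β k_ν(u)) = u^{β̄} k_{ν̄}(u)` for `u > 0`. [folklore] -/
theorem conj_besselShape {a u : ℝ} (ha : 0 < a) (hu : 0 < u) (β ν : ℂ) :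
    conj (besselShape β a ν u) = besselShape (conj β) a (conj ν) u := by
  have h : (u : ℂ).arg ≠ Real.pi := by
    rw [Complex.arg_ofReal_of_nonneg hu.le]; exact Real.pi_ne_zero.symm
  rw [besselShape, besselShape, map_mul, conj_besselMode ha hu, Complex.cpow_conj _ _ h, Complex.conj_ofReal]

/-- `u^β e^{-au} · u^{β'} e^{-a'u} = u^{β+β'} e^{-(a+a')u}` for `u > 0`: `exp × exp` is an `expShape`, whose
Mellin transform is `integral_expShape_mul`. [folklore] -/
theorem expShape_mul_expShape {u : ℝ} (hu : 0 < u) (β β' : ℂ) (a a' : ℝ) :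
    expShape β a u * expShape β' a' u = expShape (β + β') (a + a') u := by
  have hu0 : (u : ℂ) ≠ 0 := Complex.ofReal_ne_zero.mpr hu.ne'
  rw [expShape, expShape, expShape, Complex.cpow_add _ _ hu0, Complex.ofReal_add,
    show -((a : ℂ) + a') * u = -(a : ℂ) * u + -(a' : ℂ) * u by ring, Complex.exp_add]
  ring

/-- `u^β e^{-au} · u^{β'} k_ν(u) · u^w = 2 u^{z-1} e^{-au} K_{iν}(au)`, `z = β + β' + w + 3/2`, for `u > 0`. [folklore] -/
theorem expShape_mul_besselShape_mul_cpow {a u : ℝ} (ha : 0 < a) (hu : 0 < u) (β β' ν w : ℂ) :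
    expShape β a u * besselShape β' a ν u * (u : ℂ) ^ w =
      2 * ((u : ℂ) ^ (β + β' + w + 3 / 2 - 1) * Complex.exp (-((a * u : ℝ) : ℂ)) * besselK (Complex.I * ν) ((a * u : ℝ) : ℂ)) := by
  have hu0 : (u : ℂ) ≠ 0 := Complex.ofReal_ne_zero.mpr hu.ne'
  rw [expShape, besselShape, besselMode_eq_two_mul_sqrt_mul_besselK ha hu, Real.sqrt_eq_rpow, Complex.ofReal_cpow hu.le,
    show β + β' + w + 3 / 2 - 1 = β + β' + ((1 / 2 : ℝ) : ℂ) + w by push_cast; ring,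
    Complex.cpow_add _ _ hu0, Complex.cpow_add _ _ hu0, Complex.cpow_add _ _ hu0]
  push_cast
  ring

/-- `u^β k_ν(u) · u^{β'} k_{ν'}(u) · u^w = 4 u^{z-1} K_{iν}(au) K_{iν'}(au)`, `z = β + β' + w + 2`, for `u > 0`. [folklore] -/
theorem besselShape_mul_besselShape_mul_cpow {a u : ℝ} (ha : 0 < a) (hu : 0 < u) (β β' ν ν' w : ℂ) :
    besselShape β a ν u * besselShape β' a ν' u * (u : ℂ) ^ w =
      4 * ((u : ℂ) ^ (β + β' + w + 2 - 1) *
        (besselK (Complex.I * ν) ((a * u : ℝ) : ℂ) * besselK (Complex.I * ν') ((a * u : ℝ) : ℂ))) := by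
  have hu0 : (u : ℂ) ≠ 0 := Complex.ofReal_ne_zero.mpr hu.ne'
  have hsq : (Real.sqrt u : ℂ) * (Real.sqrt u : ℂ) = u := by
    rw [← Complex.ofReal_mul, Real.mul_self_sqrt hu.le]
  rw [besselShape, besselShape, besselMode_eq_two_mul_sqrt_mul_besselK ha hu, besselMode_eq_two_mul_sqrt_mul_besselK ha hu,
    show β + β' + w + 2 - 1 = β + β' + 1 + w by ring, Complex.cpow_add _ _ hu0, Complex.cpow_add _ _ hu0,
    Complex.cpow_add _ _ hu0, Complex.cpow_one]
  linear_combination (4 * (u : ℂ) ^ β * (u : ℂ) ^ β' * (u : ℂ) ^ w *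
    (besselK (Complex.I * ν) ((a * u : ℝ) : ℂ) * besselK (Complex.I * ν') ((a * u : ℝ) : ℂ))) * hsq

end Algebra

/-! ### 2. Mellin transforms on `(0, ∞)` of products of shapes -/

section HalfLine

/-- **`exp × K`**: `∫₀^∞ u^β e^{-au} · u^{β'} k_ν(u) · u^w du = 2 a^{-z} √π Γ(z + iν) Γ(z - iν) / (2^z Γ(z + ½))`,
`z = β + β' + w + 3/2`, for `|im ν| < re z`, with integrability (`k_ν(u) = 2√u K_{iν}(au)`; the substitution
`y = au` in `∫₀^∞ y^{z-1} e^{-y} K_{iν}(y) dy`, `BesselKExpMellin`). The local integral of the archimedean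
Rankin–Selberg computation for a discrete series against a principal series of `GL₂(ℝ)`.
[cite: Jacquet1972GL2II, §17–§19] -/
theorem integral_expShape_mul_besselShape_mul_cpow {a : ℝ} (ha : 0 < a) {β β' ν w : ℂ}
    (h : |ν.im| < (β + β' + w + 3 / 2).re) :
    IntegrableOn (fun u : ℝ => expShape β a u * besselShape β' a ν u * (u : ℂ) ^ w) (Ioi 0) ∧
    ∫ u in Ioi (0 : ℝ), expShape β a u * besselShape β' a ν u * (u : ℂ) ^ w =
      2 * (a : ℂ) ^ (-(β + β' + w + 3 / 2)) *
        ((Real.sqrt Real.pi : ℂ) * Complex.Gamma (β + β' + w + 3 / 2 + Complex.I * ν) *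
          Complex.Gamma (β + β' + w + 3 / 2 - Complex.I * ν) /
          ((2 : ℂ) ^ (β + β' + w + 3 / 2) * Complex.Gamma (β + β' + w + 3 / 2 + 1 / 2))) := by
  set z : ℂ := β + β' + w + 3 / 2 with hz
  have ha0 : (a : ℂ) ≠ 0 := Complex.ofReal_ne_zero.mpr ha.ne'
  have h' : |(Complex.I * ν).re| < z.re := by rwa [Complex.I_mul_re, abs_neg]
  -- the unscaled integrand `G₀(y) = e^{-y} · y^{z-1} K_{iν}(y)` and its integrability
  set G₀ : ℝ → ℂ := fun y => Complex.exp (-(y : ℂ)) * ((y : ℂ) ^ (z - 1) * besselK (Complex.I * ν) y) with hG₀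
  have hKint : IntegrableOn (fun y : ℝ => (y : ℂ) ^ (z - 1) * besselK (Complex.I * ν) y) (Ioi 0) :=
    integrableOn_cpow_mul_besselK h'
  have hG₀int : IntegrableOn G₀ (Ioi 0) := by
    refine Integrable.mono hKint ?_ ?_
    · exact ((Complex.continuous_exp.comp (Complex.continuous_ofReal.neg)).aestronglyMeasurable).mul hKint.aestronglyMeasurable
    · refine (ae_restrict_iff' measurableSet_Ioi).2 (Eventually.of_forall fun y hy => ?_)
      rw [hG₀, norm_mul, Complex.norm_exp]
      have hle : Real.exp ((-(y : ℂ)).re) ≤ 1 := by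
        rw [Complex.neg_re, Complex.ofReal_re]
        exact Real.exp_le_one_iff.mpr (by linarith [le_of_lt (show (0 : ℝ) < y from hy)])
      calc Real.exp ((-(y : ℂ)).re) * ‖(y : ℂ) ^ (z - 1) * besselK (Complex.I * ν) y‖
          ≤ 1 * ‖(y : ℂ) ^ (z - 1) * besselK (Complex.I * ν) y‖ := mul_le_mul_of_nonneg_right hle (norm_nonneg _)
        _ = _ := one_mul _
  have hG₀val : ∫ y in Ioi (0 : ℝ), G₀ y =
      (Real.sqrt Real.pi : ℂ) * Complex.Gamma (z + Complex.I * ν) * Complex.Gamma (z - Complex.I * ν) /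
        ((2 : ℂ) ^ z * Complex.Gamma (z + 1 / 2)) := by
    rw [← integral_cpow_mul_exp_neg_mul_besselK h']
    refine setIntegral_congr_fun measurableSet_Ioi fun y _ => ?_
    simp only [hG₀]; ring
  -- the scaled integrand: `f(u) = 2 a^{-(z-1)} G₀(au)` on `(0,∞)`
  have hpt : EqOn (fun u : ℝ => expShape β a u * besselShape β' a ν u * (u : ℂ) ^ w)
      (fun u : ℝ => (2 * (a : ℂ) ^ (-(z - 1))) * G₀ (a * u)) (Ioi 0) := by
    intro u hu
    have hu' : (0 : ℝ) < u := hu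
    simp only [hG₀]
    rw [expShape_mul_besselShape_mul_cpow ha hu', ← hz, Complex.ofReal_mul,
      Complex.mul_cpow_ofReal_nonneg ha.le hu'.le, Complex.cpow_neg]
    have haz : (a : ℂ) ^ (z - 1) ≠ 0 := by
      rw [Ne, Complex.cpow_eq_zero_iff, not_and_or]
      exact Or.inl ha0
    field_simp
  have hscaled : IntegrableOn (fun u : ℝ => G₀ (a * u)) (Ioi 0) := by
    have := (MeasureTheory.integrableOn_Ioi_comp_mul_left_iff G₀ 0 ha).mpr (by rwa [mul_zero])
    exact this
  refine ⟨(IntegrableOn.congr_fun (hscaled.const_mul _) hpt.symm measurableSet_Ioi), ?_⟩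
  rw [setIntegral_congr_fun measurableSet_Ioi hpt, MeasureTheory.integral_const_mul]
  have hsub := MeasureTheory.integral_comp_mul_left_Ioi G₀ 0 ha
  rw [mul_zero] at hsub
  rw [hsub, hG₀val, Complex.real_smul, Complex.ofReal_inv, Complex.cpow_neg, Complex.cpow_neg, Complex.cpow_sub _ _ ha0,
    Complex.cpow_one]
  field_simp

/-- **`K × K`**: `∫₀^∞ u^β k_ν(u) · u^{β'} k_{ν'}(u) · u^w du = 4 a^{-z} 2^{z-3} ∏_{±,±} Γ((z ± iν ± iν')/2) / Γ(z)`,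
`z = β + β' + w + 2`, for `|im ν| + |im ν'| < re z`, with integrability (`k_ν(u) = 2√u K_{iν}(au)`; the tree's
Mellin transform of `K_μ(cy) K_ν(cy)`, `BesselKProductMellin`). The local integral of the archimedean
Rankin–Selberg computation for two principal series of `GL₂(ℝ)`. [cite: Jacquet1972GL2II, §17–§19] -/
theorem integral_besselShape_mul_besselShape_mul_cpow {a : ℝ} (ha : 0 < a) {β β' ν ν' w : ℂ}
    (h : |ν.im| + |ν'.im| < (β + β' + w + 2).re) :
    IntegrableOn (fun u : ℝ => besselShape β a ν u * besselShape β' a ν' u * (u : ℂ) ^ w) (Ioi 0) ∧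
    ∫ u in Ioi (0 : ℝ), besselShape β a ν u * besselShape β' a ν' u * (u : ℂ) ^ w =
      4 * ((a : ℂ) ^ (-(β + β' + w + 2)) * ((2 : ℂ) ^ (β + β' + w + 2 - 3) *
        (Complex.Gamma ((β + β' + w + 2 + Complex.I * ν + Complex.I * ν') / 2) *
          Complex.Gamma ((β + β' + w + 2 + Complex.I * ν - Complex.I * ν') / 2) *
          Complex.Gamma ((β + β' + w + 2 - Complex.I * ν + Complex.I * ν') / 2) *
          Complex.Gamma ((β + β' + w + 2 - Complex.I * ν - Complex.I * ν') / 2)) /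
        Complex.Gamma (β + β' + w + 2))) := by
  set z : ℂ := β + β' + w + 2 with hz
  have h' : |(Complex.I * ν).re| + |(Complex.I * ν').re| < z.re := by rwa [Complex.I_mul_re, Complex.I_mul_re, abs_neg, abs_neg]
  have hpt : EqOn (fun u : ℝ => besselShape β a ν u * besselShape β' a ν' u * (u : ℂ) ^ w)
      (fun u : ℝ => 4 * ((u : ℂ) ^ (z - 1) *
        (besselK (Complex.I * ν) ((a * u : ℝ) : ℂ) * besselK (Complex.I * ν') ((a * u : ℝ) : ℂ)))) (Ioi 0) :=
    fun u hu => besselShape_mul_besselShape_mul_cpow ha hu β β' ν ν' w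
  have hint := integrableOn_cpow_mul_besselK_mul_besselK_mul (μ := Complex.I * ν) (ν := Complex.I * ν') ha h'
  refine ⟨IntegrableOn.congr_fun (hint.const_mul 4) hpt.symm measurableSet_Ioi, ?_⟩
  rw [setIntegral_congr_fun measurableSet_Ioi hpt, MeasureTheory.integral_const_mul,
    integral_cpow_mul_besselK_mul_besselK_mul (μ := Complex.I * ν) (ν := Complex.I * ν') ha h']

end HalfLine

/-! ### 3. The radial `K × K` integral over `ℂ` -/

section ComplexPlace

/-- **Radial `K × K` over `ℂ`** (polar coordinates): `∫_ℂ |z|^β k_ν(|z|) · |z|^{β'} k_{ν'}(|z|) · (|z|²)^w dz =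
2π · 4 a^{-z'} 2^{z'-3} ∏_{±,±} Γ((z' ± iν ± iν')/2) / Γ(z')`, `z' = β + β' + 2w + 3`, for
`|im ν| + |im ν'| < re z'`, with integrability. The local integral of the archimedean Rankin–Selberg
computation at a complex place. [cite: Jacquet1972GL2II, §17–§19] -/
theorem integral_complex_besselShape_mul_besselShape {a : ℝ} (ha : 0 < a) {β β' ν ν' w : ℂ}
    (h : |ν.im| + |ν'.im| < (β + β' + 2 * w + 3).re) :
    Integrable (fun x : ℂ => besselShape β a ν ‖x‖ * besselShape β' a ν' ‖x‖ * ((‖x‖ ^ 2 : ℝ) : ℂ) ^ w) ∧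
    ∫ x : ℂ, besselShape β a ν ‖x‖ * besselShape β' a ν' ‖x‖ * ((‖x‖ ^ 2 : ℝ) : ℂ) ^ w =
      2 * Real.pi * (4 * ((a : ℂ) ^ (-(β + β' + 2 * w + 3)) * ((2 : ℂ) ^ (β + β' + 2 * w + 3 - 3) *
        (Complex.Gamma ((β + β' + 2 * w + 3 + Complex.I * ν + Complex.I * ν') / 2) *
          Complex.Gamma ((β + β' + 2 * w + 3 + Complex.I * ν - Complex.I * ν') / 2) *
          Complex.Gamma ((β + β' + 2 * w + 3 - Complex.I * ν + Complex.I * ν') / 2) *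
          Complex.Gamma ((β + β' + 2 * w + 3 - Complex.I * ν - Complex.I * ν') / 2)) /
        Complex.Gamma (β + β' + 2 * w + 3)))) := by
  -- the radial profile `H(r) = Φ(r) Φ'(r) (r²)^w` and `r H(r) = Φ Φ' r^{2w+1}`
  set H : ℝ → ℂ := fun r => besselShape β a ν r * besselShape β' a ν' r * (((r ^ 2 : ℝ)) : ℂ) ^ w with hH
  have hsq : ∀ {r : ℝ}, 0 < r → (r : ℂ) * (((r ^ 2 : ℝ)) : ℂ) ^ w = (r : ℂ) ^ (2 * w + 1) := fun {r} hr => by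
    have hr0 : (r : ℂ) ≠ 0 := Complex.ofReal_ne_zero.mpr hr.ne'
    have hr2 : ((r ^ 2 : ℝ) : ℂ) ≠ 0 := Complex.ofReal_ne_zero.mpr (pow_ne_zero 2 hr.ne')
    have e : (((r ^ 2 : ℝ)) : ℂ) ^ w = (r : ℂ) ^ (2 * w) := by
      rw [Complex.cpow_def_of_ne_zero hr2, Complex.cpow_def_of_ne_zero hr0, ← Complex.ofReal_log (pow_nonneg hr.le 2),
        ← Complex.ofReal_log hr.le, Real.log_pow]
      congr 1; push_cast; ring
    rw [e, show 2 * w + 1 = 1 + 2 * w by ring, Complex.cpow_add _ _ hr0, Complex.cpow_one]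
  have hkey : EqOn (fun r : ℝ => (r : ℂ) * H r)
      (fun r : ℝ => besselShape β a ν r * besselShape β' a ν' r * (r : ℂ) ^ (2 * w + 1)) (Ioi 0) := fun r hr => by
    simp only [hH]
    rw [← hsq hr]; ring
  have h2 : |ν.im| + |ν'.im| < (β + β' + (2 * w + 1) + 2).re := by
    rwa [show β + β' + (2 * w + 1) + 2 = β + β' + 2 * w + 3 by ring]
  obtain ⟨hintR, hvalR⟩ := integral_besselShape_mul_besselShape_mul_cpow ha (β := β) (β' := β') (ν := ν) (ν' := ν') (w := 2 * w + 1) h2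
  have hcont : ContinuousOn H (Ioi 0) := by
    refine ((continuousOn_besselShape β ha ν).mul (continuousOn_besselShape β' ha ν')).mul fun r hr => ?_
    have hc := Complex.continuousAt_ofReal_cpow_const (r ^ 2) w (Or.inr (pow_ne_zero 2 (ne_of_gt hr)))
    exact (ContinuousAt.comp (f := fun r : ℝ => r ^ 2) (g := fun x : ℝ => (x : ℂ) ^ w) hc
      ((continuous_pow 2).continuousAt)).continuousWithinAt
  have hintR' : IntegrableOn (fun r : ℝ => (r : ℂ) * H r) (Ioi 0) := hintR.congr_fun hkey.symm measurableSet_Ioi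
  refine ⟨integrable_radial hcont hintR', ?_⟩
  change ∫ x : ℂ, H ‖x‖ = _
  rw [integral_complex_radial H, setIntegral_congr_fun measurableSet_Ioi hkey, hvalR,
    show β + β' + (2 * w + 1) + 2 = β + β' + 2 * w + 3 by ring]

end ComplexPlace

end Literature.NumberTheory.Automorphic
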